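import Literature.NumberTheory.EllipticCurves.KellerYin2024.PotentiallyGoodOrdinaryHeegnerPointMainConjecture
import HarnessLib

/-!
# Keller–Yin (arXiv:2410.23241) Conjecture 3.3.1 — Perrin-Riou's HEEGNER POINT MAIN CONJECTURE for the
# Heegner pair `(f̃, χ_ε)` of an elliptic curve with ADDITIVE, potentially good ordinary reduction
# (Case (I), `e = 2`) — TYPED as a conjecture leaf (nothing asserted), with its kernel bookkeeping PROVED

STAGED by the cross-ladder literature-typing layer (cell `bsd-littype`, seat 06, gen-3 successor;
D-0088(4); HOME `run/shared/lean/pub/bsd-littype/`, OPEN-QUESTIONS-06 §C-1/§D) for planners: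
conjectures are not Literature (CONVENTIONS §4), so the one conjecture Keller–Yin STATE in §3 (and
prove the Eisenstein cell of, Thm. 3.5.1) is filed here, next to `SelmerCorankPConverse.lean`
(their Conj. 0.1.1), in EXACTLY the currency of the Literature claims that prove cells of it
(`KellerYin2024.HPMCEquality D F X` over `LambdaAdicSelmerData` / `TwistedHeegnerFamily` /
`SelmerDualData`, file `KellerYin2024/PotentiallyGoodOrdinaryHeegnerPointMainConjecture.lean`) and of
the PUBLISHED untwisted sibling (Castella–Grossi–Skinner 2025 Thm. C = Perrin-Riou's conjecture at a
good Eisenstein prime, `CastellaGrossiSkinner2025.thmC_…`). HONEST FRAMING (cell, verbatim): "no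
tranche here proves BSD; … typed ≠ proved ≠ endorsed". Nothing in this file is asserted: one
hypothesis bundle, two `@[conjecture]` predicates and PROVED edges.

## The printed statement (T. Keller, M. Yin, arXiv:2410.23241v1 (2024-10-30, PREPRINT), §3.3, held
LaTeXML text `paper:arxiv-2410.23241`, chunk p0016 L83–L88)

"**Conjecture 3.3.1** (Heegner Point Main Conjecture). `H¹_{𝓕_{Λ,ε}}(K, 𝐓_ε)` has `Λ`-rank one and
there is a finitely generated torsion `Λ`-module `M` such that (i) `𝒳 ∼ Λ ⊕ M ⊕ M`,
(ii) `Char_Λ(M) = Char_Λ(H¹_{𝓕_{Λ,ε}}(K, 𝐓_ε)/Λκ₁)` where `κ₁` is a class coming from a Heegner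
point associated to the Heegner pair `(f̃, χ_ε)` as in [JLZ21]." Standing conventions of §3 (p0013
L1–L6, p0015 L10, p0016 L58–L59 "We will keep the conventions from (goodIwa) and notations from
(tword)"): `E/ℚ` an elliptic curve, `p` a prime of potentially good ordinary reduction, `f = f̃ ⊗ ε`,
"Case (I) … From now on, we assume `p ∤ N′`"; §2 conventions (Assumption 2.0.3, p0008 L5–L11): `K`
imaginary quadratic, `p = v v̄` split, every `ℓ ∣ N` split (Heeg), `D_K < −3` odd; `K_∞/K` the
anticyclotomic `ℤ_p`-extension. NOT among the hypotheses of the conjecture (they enter only Thms.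
3.3.4–3.5.1): `p > 2`, `E[p]` reducible, the lattice normalisation, `H⁰(K, ρ̄_{f̃} ⊗ ε) = 0`.

## What this file declares

* `TwistedHPMCSetting W W′ K p κ γ N N′` — the conventions above for the Heegner pair of an elliptic
  curve READ AT `e = 2` (the scope where the tree's vocabulary `TwistedHeegnerFamily` means the
  pair's Heegner classes: `ε = (·/p)`, `f̃ = f_{E′}`, `E′ = W′ ≅_ℚ E^{(p*)}`, `N = N′p²`; HOME
  OPEN-QUESTIONS-06 Q-B1/§C-1) plus the tree-vocabulary EXTRA `p ∤ h_K` (as in every Heegner-family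
  statement of the tree; flag KYb-hK) — a SPECIAL CASE of the printed generality (general Heegner
  pairs `(f̃, χ)`, `p ∣ h_K`). `TwistedHPMCAt … jbar` — the conjecture AT these data: for every
  `Λ`-adic Selmer datum `D`, twisted Heegner family `F`, Selmer-dual datum `X`,
  `KellerYin2024.HPMCEquality D F X` (ranks one; `char_Λ(𝒳_tors) = char_Λ(𝔖/ℋ^θ_∞)²` — "(i)+(ii)" on
  characteristic ideals, the `M ⊕ M` structure not recorded, WEAKER; `Λκ₁` read as the module
  `ℋ^θ_∞ = twistedHeegnerModule D F`, flag KYb-kappa). `kellerYin2024_conjecture_3_3_1` — the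
  sentence over all such data. Both `@[conjecture]`, nothing asserted.
* PROVED edges: `TwistedHPMCSetting.of_hpmcHypotheses` (Keller–Yin's Eisenstein hypotheses
  `HPMCHypotheses` contain the setting), `twistedHPMCAt_of_thm351_hpmc_OPEN` (the CLAIM Thm. 3.5.1
  proves the conjecture on its cell: `p > 2` Eisenstein, lattice normalised, `E(K)[p] = 0`),
  `charIdeal_torsion_dvd_of_twistedHPMCAt` / `sq_dvd_of_twistedHPMCAt` (the two divisibilities,
  Howard-Theorem-B shape), `hpmcDivisibility_of_twistedHPMCAt`.

Consumers (OPEN-QUESTIONS-06 §C-1, §D): route `SchneiderFreeAdditiveX3` (a `--conditional-on`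
alternative to the preprint claim on the cell `SubGordTwo`), KOLY road (twisted Heegner Kolyvagin
systems), rank-`≤ 1` residual cells X3 (additive potentially good ordinary). A planner who wants it
under `Summits/BirchSwinnertonDyer/BirchSwinnertonDyer/Theorems/` should MOVE this file, not restate it.

## References
* [KellerYin2024PotOrd] arXiv:2410.23241v1: Conj. 3.3.1 (p0016 L83–L88), §3 conventions (p0013,
  p0015 L10), Assumption 2.0.3 (p0008 L5–L11), Thm. 3.5.1 (p0020 L23–L34).
* [PerrinRiou1987BSMF] Conj. B (the untwisted original); [Howard2004HeegnerKolyvagin] Thm. B;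
  [CastellaGrossiSkinner2025] Thm. C (the published good Eisenstein cell of the untwisted conjecture).
-/

noncomputable section

open scoped Classical

open WeierstrassCurve NumberField IsDedekindDomain Field Literature.NumberTheory.EllipticCurves
  Literature.NumberTheory.EllipticCurves.Rank1Residual
  Literature.NumberTheory.EllipticCurves.KellerYin2024

namespace Summit.BirchSwinnertonDyer.Rank1Residual.TwistedHPMC

/-- **The standing conventions of Keller–Yin §3 for the Heegner pair of an elliptic curve, read at
`e = 2`** (module docstring): `E = W/ℚ` of conductor `N` (`level`) `= N′p²` (`level_eq`), "Case (I),
`p ∤ N′`" (`not_dvd_level`, `caseOne`), `W′ ≅_ℚ E^{(p*)}` the auxiliary curve with newform `f̃`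
(`twist`), Assumption 2.0.3 (`imagQuad`, `heegner`, `odd`, `ne_neg_three`, `split`), `κ` the
anticyclotomic `ℤ_p`-extension with topological generator `γ` (`anticyclotomic`, `topGenerator`),
and the tree-vocabulary EXTRA `p ∤ h_K` (`not_dvd_classNumber`). A conjunction of hypotheses; nothing
asserted. [cite: KellerYin2024PotOrd, §3 conventions (p0013 L1–L6, p0015 L10) and Assumption 2.0.3 (p0008 L5–L11)] -/
structure TwistedHPMCSetting (W W' : WeierstrassCurve ℚ) [W.IsElliptic] [W.IsGloballyMinimal]
    (K : Type) [Field K] [NumberField K] (p : ℕ) [Fact p.Prime] (κ : ZpExtension K p)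
    (γ : absoluteGaloisGroup K) (N N' : ℕ) : Prop where
  level : W.conductorNorm ℤ = N
  level_eq : N = N' * p ^ 2
  not_dvd_level : ¬ p ∣ N'
  caseOne : W.HasGoodOrdinaryReductionOverQuadraticAt p
  twist : ∃ C : VariableChange ℚ, C • W.quadraticTwist ((-1 : ℚ) ^ (p / 2) * p) = W'
  imagQuad : IsImaginaryQuadratic K
  heegner : SatisfiesHeegnerHypothesis N K
  odd : Odd (NumberField.discr K)
  ne_neg_three : NumberField.discr K ≠ -3
  split : ((Ideal.span {(p : ℤ)}).primesOver (𝓞 K)).ncard = 2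
  anticyclotomic : κ.IsAnticyclotomic
  topGenerator : κ.IsTopGenerator γ
  not_dvd_classNumber : ¬ p ∣ NumberField.classNumber K

/-- **Keller–Yin Conjecture 3.3.1 AT the data** `(W, W′, K, p, κ, γ, N, N′, jbar)`: under the
standing conventions, for every `Λ`-adic Selmer datum `D` (`𝔖 = H¹_{𝓕_{Λ,ε}}(K, 𝐓_ε)`, `T_ε = T_pE`),
twisted Heegner family `F` (whose module `ℋ^θ_∞` reads `Λκ₁`) and Selmer-dual datum `X` (`𝒳`):
`𝔖`, `𝒳` finitely generated of `Λ`-rank one and `char_Λ(𝒳_tors) = char_Λ(𝔖/ℋ^θ_∞)²`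
(`KellerYin2024.HPMCEquality D F X`; "(i) `𝒳 ∼ Λ ⊕ M ⊕ M`, (ii) `Char_Λ(M) = Char_Λ(𝔖/Λκ₁)`" on
characteristic ideals). A predicate; nothing asserted; OPEN except on the cell of Thm. 3.5.1
(`twistedHPMCAt_of_thm351_hpmc_OPEN`, itself a preprint CLAIM).
[cite: KellerYin2024PotOrd, Conj. 3.3.1 (§3.3, held chunk p0016 L83–L88)] -/
@[conjecture] def TwistedHPMCAt (W W' : WeierstrassCurve ℚ) [W.IsElliptic] [W.IsGloballyMinimal]
    (K : Type) [Field K] [NumberField K] (p : ℕ) [Fact p.Prime] (κ : ZpExtension K p)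
    (γ : absoluteGaloisGroup K) (N N' : ℕ) [NeZero N'] (jbar : AlgebraicClosure K →+* ℂ) : Prop :=
  ∀ (_ : TwistedHPMCSetting W W' K p κ γ N N') (D : (W.baseChange K).LambdaAdicSelmerData κ γ)
    (F : TwistedHeegnerFamily N' W W' K κ jbar) (X : (W.baseChange K).SelmerDualData κ γ),
    HPMCEquality D F X

/-- **Keller–Yin, arXiv:2410.23241, Conjecture 3.3.1 (Heegner Point Main Conjecture for the Heegner
pair of an elliptic curve), verbatim**: "`H¹_{𝓕_{Λ,ε}}(K, 𝐓_ε)` has `Λ`-rank one and there is a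
finitely generated torsion `Λ`-module `M` such that (i) `𝒳 ∼ Λ ⊕ M ⊕ M`, (ii)
`Char_Λ(M) = Char_Λ(H¹_{𝓕_{Λ,ε}}(K, 𝐓_ε)/Λκ₁)` where `κ₁` is a class coming from a Heegner point
associated to the Heegner pair `(f̃, χ_ε)` as in [JLZ21]." — over all data satisfying the standing
conventions of §3 read at `e = 2` (`TwistedHPMCAt`). A conjecture STATED, not proved, by the source
(proved there on the Eisenstein cell, Thm. 3.5.1); nothing asserted here.
[cite: KellerYin2024PotOrd, Conj. 3.3.1 (§3.3, held chunk p0016 L83–L88)] -/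
@[conjecture] def kellerYin2024_conjecture_3_3_1 : Prop :=
  ∀ (W W' : WeierstrassCurve ℚ) [W.IsElliptic] [W.IsGloballyMinimal] (K : Type) [Field K]
    [NumberField K] (p : ℕ) [Fact p.Prime] (κ : ZpExtension K p) (γ : absoluteGaloisGroup K)
    (N N' : ℕ) [NeZero N'] (jbar : AlgebraicClosure K →+* ℂ),
    TwistedHPMCAt W W' K p κ γ N N' jbar

variable {W W' : WeierstrassCurve ℚ} [W.IsElliptic] [W.IsGloballyMinimal] {K : Type} [Field K]
  [NumberField K] {p : ℕ} [Fact p.Prime] {κ : ZpExtension K p} {γ : absoluteGaloisGroup K}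
  {N N' : ℕ}

/-- Unfolding lemma. [cite: KellerYin2024PotOrd, Conj. 3.3.1] -/
theorem twistedHPMCAt_iff [NeZero N'] {jbar : AlgebraicClosure K →+* ℂ} :
    TwistedHPMCAt W W' K p κ γ N N' jbar ↔
      ∀ (_ : TwistedHPMCSetting W W' K p κ γ N N') (D : (W.baseChange K).LambdaAdicSelmerData κ γ)
        (F : TwistedHeegnerFamily N' W W' K κ jbar) (X : (W.baseChange K).SelmerDualData κ γ),
        HPMCEquality D F X :=
  Iff.rfl

/-! ### (1) Keller–Yin's Eisenstein hypotheses contain the setting; Thm. 3.5.1 proves the cell -/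

/-- **`HPMCHypotheses` ⟹ `TwistedHPMCSetting`**: the hypotheses of Keller–Yin's Thms. 3.3.6/3.5.1
(Literature `KellerYin2024.HPMCHypotheses`: the gen-0 `PotOrdSetting` + `N = N′p²`, `p ∤ N′`, twist,
`γ`, `p ∤ h_K`) contain the standing conventions of the conjecture (they ADD `p > 2`, `E[p]`
reducible with the lattice normalisation and `E(K)[p] = 0`, and the embedding datum `ι′, v, v̄`).
[cite: KellerYin2024PotOrd, Thm. 3.5.1 hypotheses (p0020 L23–L25) vs Conj. 3.3.1] -/
theorem TwistedHPMCSetting.of_hpmcHypotheses {ι' : PadicAlgCl p ≃+* ℂ}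
    {v vbar : HeightOneSpectrum (𝓞 K)} (h : HPMCHypotheses ι' W W' K v vbar κ γ N N') :
    TwistedHPMCSetting W W' K p κ γ N N' where
  level := h.setting.level
  level_eq := h.level_eq
  not_dvd_level := h.not_dvd_level
  caseOne := h.setting.caseOne
  twist := h.twist
  imagQuad := h.setting.imagQuad
  heegner := h.setting.heegner
  odd := h.setting.odd
  ne_neg_three := h.setting.ne_neg_three
  split := h.setting.split
  anticyclotomic := h.setting.anticyclotomic
  topGenerator := h.topGenerator
  not_dvd_classNumber := h.not_dvd_classNumber

/-- **Thm. 3.5.1 (the CLAIM `thm351_hpmc_equality_OPEN`) proves Conjecture 3.3.1 on its cell**: under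
Keller–Yin's Eisenstein hypotheses `HPMCHypotheses ι′ W W′ K v v̄ κ γ N N′` the conclusion of the
conjecture holds at every `(D, F, X)`. CONDITIONAL on an unrefereed preprint claim; nothing asserted.
[cite: KellerYin2024PotOrd, Thm. 3.5.1 (p0020 L23–L34) and Conj. 3.3.1 (p0016 L83–L88)] -/
theorem hpmcEquality_of_thm351_hpmc_OPEN (h351 : thm351_hpmc_equality_OPEN)
    {ι' : PadicAlgCl p ≃+* ℂ} {v vbar : HeightOneSpectrum (𝓞 K)} [NeZero N']
    (jbar : AlgebraicClosure K →+* ℂ) (hyp : HPMCHypotheses ι' W W' K v vbar κ γ N N')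
    (D : (W.baseChange K).LambdaAdicSelmerData κ γ) (F : TwistedHeegnerFamily N' W W' K κ jbar)
    (X : (W.baseChange K).SelmerDualData κ γ) : HPMCEquality D F X :=
  h351 ι' W W' K v vbar κ γ jbar hyp D F X

/-- **The conjecture AT the data from Thm. 3.5.1, when the data carry the Eisenstein hypotheses**:
if SOME `(ι′, v, v̄)` makes `HPMCHypotheses` hold, `TwistedHPMCAt` holds (its own hypothesis
`TwistedHPMCSetting` is then not even needed). CONDITIONAL on the preprint claim.
[cite: KellerYin2024PotOrd, Thm. 3.5.1 (p0020 L23–L34)] -/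
theorem twistedHPMCAt_of_thm351_hpmc_OPEN (h351 : thm351_hpmc_equality_OPEN)
    {ι' : PadicAlgCl p ≃+* ℂ} {v vbar : HeightOneSpectrum (𝓞 K)} [NeZero N']
    (jbar : AlgebraicClosure K →+* ℂ) (hyp : HPMCHypotheses ι' W W' K v vbar κ γ N N') :
    TwistedHPMCAt W W' K p κ γ N N' jbar :=
  fun _ D F X ↦ hpmcEquality_of_thm351_hpmc_OPEN h351 jbar hyp D F X

/-! ### (2) The two divisibilities (Howard-Theorem-B shape) from the conjecture at the data -/

/-- The conjecture at the data gives Thm. 3.3.6's divisibility shape `HPMCDivisibility D F X`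
(`char_Λ(𝒳_tors) ∣ char_Λ(𝔖/ℋ^θ_∞)²`, ranks one). [cite: KellerYin2024PotOrd, Conj. 3.3.1 and Thm. 3.3.6] -/
theorem hpmcDivisibility_of_twistedHPMCAt [NeZero N'] {jbar : AlgebraicClosure K →+* ℂ}
    (h : TwistedHPMCAt W W' K p κ γ N N' jbar) (hyp : TwistedHPMCSetting W W' K p κ γ N N')
    (D : (W.baseChange K).LambdaAdicSelmerData κ γ) (F : TwistedHeegnerFamily N' W W' K κ jbar)
    (X : (W.baseChange K).SelmerDualData κ γ) : HPMCDivisibility D F X :=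
  (h hyp D F X).divisibility

/-- `char_Λ(𝒳_tors) ∣ char_Λ(𝔖/ℋ^θ_∞)²` from the conjecture at the data.
[cite: KellerYin2024PotOrd, Conj. 3.3.1] [cite: Howard2004HeegnerKolyvagin, Thm. B (c) (shape)] -/
theorem charIdeal_torsion_dvd_of_twistedHPMCAt [NeZero N'] {jbar : AlgebraicClosure K →+* ℂ}
    (h : TwistedHPMCAt W W' K p κ γ N N' jbar) (hyp : TwistedHPMCSetting W W' K p κ γ N N')
    (D : (W.baseChange K).LambdaAdicSelmerData κ γ) (F : TwistedHeegnerFamily N' W W' K κ jbar)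
    (X : (W.baseChange K).SelmerDualData κ γ) :
    Module.charIdeal (IwasawaAlgebra p) (Submodule.torsion (IwasawaAlgebra p) X.X) ∣
      twistedHeegnerCharIdeal D F ^ 2 :=
  (h hyp D F X).divisibility.2.2.2

/-- `char_Λ(𝔖/ℋ^θ_∞)² ∣ char_Λ(𝒳_tors)` from the conjecture at the data (the "lower bound" half).
[cite: KellerYin2024PotOrd, Conj. 3.3.1] -/
theorem sq_dvd_of_twistedHPMCAt [NeZero N'] {jbar : AlgebraicClosure K →+* ℂ}
    (h : TwistedHPMCAt W W' K p κ γ N N' jbar) (hyp : TwistedHPMCSetting W W' K p κ γ N N')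
    (D : (W.baseChange K).LambdaAdicSelmerData κ γ) (F : TwistedHeegnerFamily N' W W' K κ jbar)
    (X : (W.baseChange K).SelmerDualData κ γ) :
    twistedHeegnerCharIdeal D F ^ 2 ∣
      Module.charIdeal (IwasawaAlgebra p) (Submodule.torsion (IwasawaAlgebra p) X.X) :=
  (h hyp D F X).sq_dvd

/-- The global sentence specialises to the conjecture at any data.
[cite: KellerYin2024PotOrd, Conj. 3.3.1] -/
theorem twistedHPMCAt_of_conjecture (h : kellerYin2024_conjecture_3_3_1) [NeZero N']
    (jbar : AlgebraicClosure K →+* ℂ) : TwistedHPMCAt W W' K p κ γ N N' jbar :=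
  h W W' K p κ γ N N' jbar

end Summit.BirchSwinnertonDyer.Rank1Residual.TwistedHPMC

end
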